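import Summits.QuantumAdvantage.QuantumAdvantage.Theorems.PeriodDialC
import HarnessLib

/-!
# PeriodDial (D) — §6: THE SEAM — no period-4-universal input at `n ≡ 2 (mod 4)`, `¬ PeriodicFailRes 2 4 r w`; axiom audit of the node's headline theorems
(decomp-qadv lens-2 g30; the node memo is the module docstring of part A = `Theorems/PeriodDialA.lean`.)  All proofs complete.
-/

set_option linter.dupNamespace false
set_option linter.style.longLine false

noncomputable section
open scoped Classical

namespace Summit.QuantumAdvantage.QuantumAdvantage.Theorems.PeriodDial
open Finset
open Literature.Computability.QuantumComplexity Literature.Computability.QuantumComplexity.RingHLF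
open Literature.Computability.MetaComplexity Literature.Computability.MetaComplexity.Smolensky
open Summit.QuantumAdvantage.AdviceFreeQNC0 (OddZeros kernel_odd)
open Summit.QuantumAdvantage.AdviceFreeQNC0.Fib19 (IsOdd isOdd_iff_oddZeros kline kline_inKernel kline_hardCore)
open Summit.QuantumAdvantage.AdviceFreeQNC0.LightConeWindowHard
  (window window_apply dot2_eq_zero_of_pairing nxt_val prv_val xor3_eq_false_iff)
open Summit.QuantumAdvantage.QuantumAdvantage.Theorems.LightDial (wt wt_le_of_val_mem lightLosing LightFail)
open Summit.QuantumAdvantage.QuantumAdvantage.Theorems.ParityDial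
  (par IsParityLocal PLocalFail PGlobalFail OGlobalFail ParityUniversalHard closes₃ pLocalFail_two_seven window_eq_of_le window_centre
   parityUniversalHard_two_all not_rel_of_isParityLocal)
open Summit.QuantumAdvantage.QuantumAdvantage.Theses.ExactnessDial (NoPerfectTwo3)

variable {n : ℕ}

/-! ## §6 THE SEAM: no period-4-universal input at `n ≡ 2 (mod 4)`; the period-4 special piece is FALSE there

With the labelling `b ↦ b mod 4` of `[0, n)` and `n ≡ 2 (mod 4)` the classes do not close up around the ring (a seam between `n − 1` and `0`).
Summing the kernel relation `[x_b v_b] ≡ [v_{b−1}] + [v_{b+1}]` over one class and re-indexing along `nxt` / `prv` (`class_kernel_identity`) shows: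
if all four class counts `|K ∩ C_c|` and all four counts `#{b ∈ K ∩ C_c : x_b = 1}` are even, then `v_0 = v_{n−1} = 0` (`seam_zero`), so a
non-zero kernel vector (hard-core: no two adjacent zeros) never has all eight radius-0 types `(b mod 4, x_b)` of even multiplicity.  But a
period-4-universal-hard input needs exactly that (else the indicator rule of an odd type wins): `not_periodicUniversalHard_four`.  By exactness
the degree-free special piece `PeriodicFailRes 2 4 r w` is false for every `r, w` (`not_periodicFailRes_two_four`): at every large `n ≡ 2 (mod 4)`
there is a PERFECT 4-periodic-local strategy (of uncontrolled degree) — the period dial turns only where `4 ∣ n`. -/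

/-- the kernel relation summed over one class mod 4 and re-indexed: `#{b ∈ K ∩ C_c : x_b = 1} + #{a ∈ K : nxt a ∈ C_c} + #{a ∈ K : prv a ∈ C_c}`
is even. -/
theorem class_kernel_identity {x v : Fin n → Bool} (hK : InKernel x v) (c : ℕ) :
    ((univ.filter fun b : Fin n => cls 4 b = c ∧ x b = true ∧ v b = true).card
      + (univ.filter fun a : Fin n => cls 4 (nxt a) = c ∧ v a = true).card
      + (univ.filter fun a : Fin n => cls 4 (prv a) = c ∧ v a = true).card) % 2 = 0 := by
  have hpt : ∀ b : Fin n, ((if (cls 4 b = c ∧ x b = true ∧ v b = true) then 1 else 0 : ℕ)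
      + (if (cls 4 b = c ∧ v (prv b) = true) then 1 else 0 : ℕ)
      + (if (cls 4 b = c ∧ v (nxt b) = true) then 1 else 0 : ℕ)) % 2 = 0 := by
    intro b
    have hb := hK b
    revert hb
    by_cases hc : cls 4 b = c <;> cases x b <;> cases v b <;> cases v (prv b) <;> cases v (nxt b) <;> simp [hc]
  have h1 : (univ.filter fun a : Fin n => cls 4 (nxt a) = c ∧ v a = true).card
      = (univ.filter fun b : Fin n => cls 4 b = c ∧ v (prv b) = true).card := by
    refine Finset.card_bij (fun a _ => nxt a) (fun a ha => ?_) (fun a₁ _ a₂ _ h => nxt_injective h) (fun b hb => ?_)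
    · simp only [mem_filter, mem_univ, true_and] at ha ⊢
      rw [prv_nxt]; exact ha
    · simp only [mem_filter, mem_univ, true_and] at hb
      exact ⟨prv b, by simp only [mem_filter, mem_univ, true_and, nxt_prv]; exact hb, nxt_prv b⟩
  have h2 : (univ.filter fun a : Fin n => cls 4 (prv a) = c ∧ v a = true).card
      = (univ.filter fun b : Fin n => cls 4 b = c ∧ v (nxt b) = true).card := by
    refine Finset.card_bij (fun a _ => prv a) (fun a ha => ?_) (fun a₁ _ a₂ _ h => prv_injective h) (fun b hb => ?_)
    · simp only [mem_filter, mem_univ, true_and] at ha ⊢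
      rw [nxt_prv]; exact ha
    · simp only [mem_filter, mem_univ, true_and] at hb
      exact ⟨nxt b, by simp only [mem_filter, mem_univ, true_and, prv_nxt]; exact hb, prv_nxt b⟩
  rw [h1, h2, card_filter, card_filter, card_filter, ← sum_add_distrib, ← sum_add_distrib, Finset.sum_nat_mod,
    Finset.sum_congr rfl (fun b _ => hpt b)]
  simp

/-- ★ THE SEAM LEMMA (`n ≡ 2 mod 4`): a kernel vector all of whose class counts `|K ∩ C_c|` and ones-counts `#{b ∈ K ∩ C_c : x_b = 1}` are even
vanishes at the two positions `0` and `n − 1` adjacent across the seam. -/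
theorem seam_zero (h4 : n % 4 = 2) {x v : Fin n → Bool} (hK : InKernel x v)
    (hcl : ∀ c, (univ.filter fun b : Fin n => cls 4 b = c ∧ v b = true).card % 2 = 0)
    (hon : ∀ c, (univ.filter fun b : Fin n => cls 4 b = c ∧ x b = true ∧ v b = true).card % 2 = 0) :
    v ⟨0, by omega⟩ = false ∧ v ⟨n - 1, by omega⟩ = false := by
  -- the shifted class conditions, made explicit (here the seam enters: `nxt (n−1) = 0`, `prv 0 = n−1`, `n − 1 ≡ 1 (mod 4)`)
  have e10 : (univ.filter fun a : Fin n => cls 4 (nxt a) = 1 ∧ v a = true) = (univ.filter fun a : Fin n => cls 4 a = 0 ∧ v a = true) := by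
    apply filter_congr; intro a _; have ha := a.isLt
    apply and_congr_left'
    unfold cls; rw [nxt_val]; split_ifs <;> (try simp only [false_iff]) <;> omega
  have e12 : (univ.filter fun a : Fin n => cls 4 (prv a) = 1 ∧ v a = true)
      = (univ.filter fun a : Fin n => cls 4 a = 2 ∧ v a = true) ∪ (univ.filter fun a : Fin n => (a : ℕ) = 0 ∧ v a = true) := by
    ext a; have ha := a.isLt
    simp only [mem_filter, mem_univ, true_and, mem_union]
    rw [← or_and_right]
    apply and_congr_left'
    unfold cls; rw [prv_val]; split_ifs <;> omega
  have e03 : (univ.filter fun a : Fin n => cls 4 (nxt a) = 0 ∧ v a = true)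
      = (univ.filter fun a : Fin n => cls 4 a = 3 ∧ v a = true) ∪ (univ.filter fun a : Fin n => (a : ℕ) = n - 1 ∧ v a = true) := by
    ext a; have ha := a.isLt
    simp only [mem_filter, mem_univ, true_and, mem_union]
    rw [← or_and_right]
    apply and_congr_left'
    unfold cls; rw [nxt_val]; split_ifs <;> (try simp only [true_iff]) <;> omega
  have e01 : (univ.filter fun a : Fin n => cls 4 (prv a) = 0 ∧ v a = true) = (univ.filter fun a : Fin n => cls 4 a = 1 ∧ v a = true) := by
    apply filter_congr; intro a _; have ha := a.isLt
    apply and_congr_left'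
    unfold cls; rw [prv_val]; split_ifs <;> omega
  have d2 : Disjoint (univ.filter fun a : Fin n => cls 4 a = 2 ∧ v a = true) (univ.filter fun a : Fin n => (a : ℕ) = 0 ∧ v a = true) :=
    disjoint_filter.2 fun a _ h1 h2 => by simp only [cls] at h1; omega
  have d3 : Disjoint (univ.filter fun a : Fin n => cls 4 a = 3 ∧ v a = true) (univ.filter fun a : Fin n => (a : ℕ) = n - 1 ∧ v a = true) :=
    disjoint_filter.2 fun a _ h1 h2 => by simp only [cls] at h1; omega
  have i1 := class_kernel_identity hK 1
  have i0 := class_kernel_identity hK 0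
  rw [e10, e12, card_union_of_disjoint d2] at i1
  rw [e03, e01, card_union_of_disjoint d3] at i0
  have c0 := hcl 0; have c1 := hcl 1; have c2 := hcl 2; have c3 := hcl 3; have o0 := hon 0; have o1 := hon 1
  -- the two singleton counts are even, hence zero
  have s0 : (univ.filter fun a : Fin n => (a : ℕ) = 0 ∧ v a = true).card % 2 = 0 := by omega
  have s1 : (univ.filter fun a : Fin n => (a : ℕ) = n - 1 ∧ v a = true).card % 2 = 0 := by omega
  constructor
  · by_contra h
    rw [Bool.not_eq_false] at h
    have e : (univ.filter fun a : Fin n => (a : ℕ) = 0 ∧ v a = true) = {⟨0, by omega⟩} := by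
      ext a; simp only [mem_filter, mem_univ, true_and, mem_singleton]
      constructor
      · rintro ⟨ha, _⟩; exact Fin.ext ha
      · rintro rfl; exact ⟨rfl, h⟩
    rw [e, card_singleton] at s0; omega
  · by_contra h
    rw [Bool.not_eq_false] at h
    have e : (univ.filter fun a : Fin n => (a : ℕ) = n - 1 ∧ v a = true) = {⟨n - 1, by omega⟩} := by
      ext a; simp only [mem_filter, mem_univ, true_and, mem_singleton]
      constructor
      · rintro ⟨ha, _⟩; exact Fin.ext ha
      · rintro rfl; exact ⟨rfl, h⟩
    rw [e, card_singleton] at s1; omega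

/-- ★★ NO PERIOD-4-UNIVERSAL INPUT AT `n ≡ 2 (mod 4)` (any radius `r ≤ n`, any weight): either the kernel line has sign bit `0` (the zero
output wins), or some radius-0 type `(c, a)` has odd multiplicity on it (its indicator rule wins), or all eight are even and the seam lemma
makes the hard-core kernel line vanish at two adjacent positions. -/
theorem not_periodicUniversalHard_four (hn : 3 ≤ n) (h4 : n % 4 = 2) {r : ℕ} (hr : r ≤ n) (x : Fin n → Bool) :
    ¬ PeriodicUniversalHard 4 r x := by
  rintro ⟨hodd, hall⟩
  have hodd' : IsOdd x := (isOdd_iff_oddZeros x).mpr hodd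
  have hJK : InKernel x (kline x) := kline_inKernel hn x hodd'
  have hker : ∀ v, InKernel x v → v = (fun _ => false) ∨ v = kline x := fun v hv => (kernel_odd hn x hodd' v).1 hv
  have signBit_zero : signBit x (fun _ => false) = 0 := by simp [signBit, edgesIn, wtAnd]
  -- the rule "class `c`, centre bit `a`" and what it takes for it to win
  have hrule : ∀ (c : ℕ) (a : Bool),
      (univ.filter fun b : Fin n => cls 4 b = c ∧ x b = a ∧ kline x b = true).card % 2 = signBit x (kline x) → False := by
    intro c a hcard
    apply hall (fun c' w => decide (c' = c) && (w ⟨r, by omega⟩ == a))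
    intro v hv
    rcases hker v hv with rfl | rfl
    · rw [signBit_zero]; simp [dot2]
    · rw [← hcard]; unfold dot2; congr 2; ext b
      simp only [mem_filter, mem_univ, true_and, perStrat, window_centre r hr, Bool.and_eq_true, decide_eq_true_eq, beq_iff_eq]
      tauto
  -- case on the sign bit of the kernel line
  rcases Nat.mod_two_eq_zero_or_one (edgesIn (kline x) + wtAnd x (kline x) / 2) with ht | ht
  · -- sign bit 0: the all-zero rule wins
    apply hall (fun _ _ => false)
    intro v hv
    rcases hker v hv with rfl | rfl
    · rw [signBit_zero]; simp [dot2]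
    · unfold signBit; rw [ht]; simp [dot2, perStrat]
  · -- sign bit 1: every radius-0 type count on the kernel line is even (else its indicator rule wins) …
    have heven : ∀ (c : ℕ) (a : Bool), (univ.filter fun b : Fin n => cls 4 b = c ∧ x b = a ∧ kline x b = true).card % 2 = 0 := by
      intro c a
      rcases Nat.mod_two_eq_zero_or_one ((univ.filter fun b : Fin n => cls 4 b = c ∧ x b = a ∧ kline x b = true).card) with h | h
      · exact h
      · exact (hrule c a (by unfold signBit; rw [ht, h])).elim
    -- … so the class counts and the ones-counts are even, and the seam lemma applies
    have hcl : ∀ c, (univ.filter fun b : Fin n => cls 4 b = c ∧ kline x b = true).card % 2 = 0 := by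
      intro c
      have hsplit : (univ.filter fun b : Fin n => cls 4 b = c ∧ kline x b = true)
          = (univ.filter fun b : Fin n => cls 4 b = c ∧ x b = true ∧ kline x b = true)
            ∪ (univ.filter fun b : Fin n => cls 4 b = c ∧ x b = false ∧ kline x b = true) := by
        ext b; simp only [mem_filter, mem_univ, true_and, mem_union]; cases x b <;> simp
      have hd : Disjoint (univ.filter fun b : Fin n => cls 4 b = c ∧ x b = true ∧ kline x b = true)
          (univ.filter fun b : Fin n => cls 4 b = c ∧ x b = false ∧ kline x b = true) :=
        disjoint_filter.2 fun b _ h1 h2 => Bool.noConfusion (h1.2.1.symm.trans h2.2.1)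
      rw [hsplit, card_union_of_disjoint hd]
      have := heven c true; have := heven c false; omega
    obtain ⟨h0, hlast⟩ := seam_zero h4 hJK hcl (fun c => heven c true)
    -- the kernel line is hard-core: positions `n − 1` and `nxt (n − 1) = 0` cannot both be zero
    have hhc := (kline_hardCore hn x hodd').1 ⟨n - 1, by omega⟩
    apply hhc
    refine ⟨hlast, ?_⟩
    have e : nxt (⟨n - 1, by omega⟩ : Fin n) = ⟨0, by omega⟩ := by
      apply Fin.ext; rw [nxt_val]; simp only; split_ifs <;> omega
    rw [e]; exact h0

/-- ★ COROLLARY: the degree-free period-4 special piece is FALSE on `n ≡ 2 (mod 4)` for every radius and weight — equivalently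
(`periodicFailRes_iff_universal`) perfect 4-periodic-local strategies exist at every large `n ≡ 2 (mod 4)`.  The period-4 split of the
leaf-residue `PGlobalFailRes 2` is therefore vacuous on the special side: that residue needs a non-periodic idea. -/
theorem not_periodicFailRes_two_four (r w : ℕ) : ¬ PeriodicFailRes 2 4 r w := by
  intro h
  obtain ⟨n₀, h₀⟩ := (periodicFailRes_iff_universal 2 4 r w).mp h
  -- a length `n ≡ 2 (mod 4)` beyond `n₀`, `r` and `3`
  obtain ⟨x, _, hx⟩ := h₀ (4 * (n₀ + r + 1) + 2) (by omega) (by omega)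
  exact not_periodicUniversalHard_four (by omega) (by omega) (by omega) x hx

/-- … while at level 2 the same residue IS covered (`periodicFailRes_two_two_seven`): on `n ≡ 2 (mod 4)` parity is the top of the periodic dial. -/
theorem periodicFailRes_two_dichotomy : PeriodicFailRes 2 2 2 7 ∧ ¬ PeriodicFailRes 2 4 2 7 :=
  ⟨periodicFailRes_two_two_seven (by norm_num), not_periodicFailRes_two_four 2 7⟩


/-! ### Axiom audit (standard axioms only) -/

/-- info: 'Summit.QuantumAdvantage.QuantumAdvantage.Theorems.PeriodDial.periodicFailRes_zero_four_two_seven' depends on axioms: [propext,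
 Classical.choice,
 Quot.sound] -/
#guard_msgs in #print axioms periodicFailRes_zero_four_two_seven

/-- info: 'Summit.QuantumAdvantage.QuantumAdvantage.Theorems.PeriodDial.periodicFailRes_iff_universal' depends on axioms: [propext,
 Classical.choice,
 Quot.sound] -/
#guard_msgs in #print axioms periodicFailRes_iff_universal

/-- info: 'Summit.QuantumAdvantage.QuantumAdvantage.Theorems.PeriodDial.leaf_iff_pieces' depends on axioms: [propext,
 Classical.choice,
 Quot.sound] -/
#guard_msgs in #print axioms leaf_iff_pieces

/-- info: 'Summit.QuantumAdvantage.QuantumAdvantage.Theorems.PeriodDial.closes' depends on axioms: [propext,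
 Classical.choice,
 Quot.sound] -/
#guard_msgs in #print axioms closes

/-- info: 'Summit.QuantumAdvantage.QuantumAdvantage.Theorems.PeriodDial.not_periodicUniversalHard_four' depends on axioms: [propext,
 Classical.choice,
 Quot.sound] -/
#guard_msgs in #print axioms not_periodicUniversalHard_four

/-- info: 'Summit.QuantumAdvantage.QuantumAdvantage.Theorems.PeriodDial.not_periodicFailRes_two_four' depends on axioms: [propext,
 Classical.choice,
 Quot.sound] -/
#guard_msgs in #print axioms not_periodicFailRes_two_four

end Summit.QuantumAdvantage.QuantumAdvantage.Theorems.PeriodDial
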